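import Summits.BirchSwinnertonDyer.BirchSwinnertonDyer.Theorems.CumulativeHeegnerLeopoldtEisensteinCharacterInvariantsAtThreeCurveLocalTameCorank
import Summits.BirchSwinnertonDyer.BirchSwinnertonDyer.Theorems.EisensteinPrimesFSideCorankLeOffP
import Literature.NumberTheory.EllipticCurves.ZpExtensionEisensteinBadPlacesLocalTorsionProofs
import HarnessLib

/-!
# STUB ALG-≥(ii) of line `birth` (crux K2-odd, stmt-23970): the LOCAL lower bound
# `mult_{X=(Nw)⁻¹} P̃_w(E_K) ≤ corank_{ℤ_3} H¹(ker κ ⊓ D_w, E[3^∞])` at every `w ∈ Sf′`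

Route `CumulativeHeegnerLeopoldt`, crux `EisensteinCharacterInvariantsAtThreeOdd` (stmt-BirchSwinnertonDyer-23970), line `birth`
(lead `bsd-line-chl-p1` g10), registered stub `stub_curveLocalCorankGe` — proved here with the registered signature VERBATIM
(`--supports stmt-BirchSwinnertonDyer-23970`). On the Leopoldt cell (`K` imaginary quadratic with (Heeg) for `N = N_E`, `κ`
anticyclotomic, `Sf′` = places `w ∋ N` with `3 ∉ w`) the place `w` lies over a prime `ℓ ∣ N`, `ℓ ≠ 3`, split in `K`, so `E_K` has at `w`
the reduction type of `E` at `ℓ` and `w` is finitely decomposed in `K_∞` (Brink; `ZpExtension.not_decomp_le_kerSubgroup_of_natCast_mem`):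

* additive — `P_w = 1` (`localPolynomialAt_of_hasAdditiveReductionAt`), multiplicity `0`;
* split multiplicative — `P̃_w = 1 − X`, multiplicity `𝟙[Nw ≡ 1 (3)]` (`SelmerAcSplitMultiplicativePlace`); when `3 ∣ Nw − 1` the
  untwisted Tate datum (`Silverman1994_thmV53_tateUniformisation_holds`, `t = 0`, `χ ≡ 1`) feeds
  `CurveLocalTameCorank.one_le_zpCorank_subgroupH1_inf_decomp` (GV Prop. (2.4), lower half): `1 ≤ corank`;
* non-split multiplicative — `P̃_w = 1 + X`, multiplicity `𝟙[Nw ≡ −1 (3)]` (`SelmerAcMultiplicativePlaceSign`); when `3 ∣ Nw + 1`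
  the twisted datum (`Silverman1994_thmV53_corV54_tateUniformisation_holds`, `t = √γ`, inertia fixes `t`, every Frobenius flips it:
  `SqrtGammaNonsplitFrobenius`) has `χ(φ) = −1`, and the same theorem gives `1 ≤ corank`.

Tool theorem (no definition, no named fact, no `sorry`); with ALG-≥(i) (`stub_curveRelaxationCorankEq`, p707562) and the door
(`EisensteinCharacterInvariantsAtThreeAlgLambdaDoor`) it yields [ALG-λ] of the line. BSD is not proved for any curve by any of this.
References: [GreenbergVatsal2000] §2 Prop. (2.4) pp. 22–23, pp. 14–15; [SilvermanATAEC1994] V.3.1, V.5.2–5.4, Ex. 5.11;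
[CastellaGrossiLeeSkinner2022] §1.4 (eq:1), L893–901; [KellerYin2024] §1.5; [Brink2007] Thm. 2.
-/

set_option autoImplicit false
-- `…BirchSwinnertonDyer.BirchSwinnertonDyer.Theorems…` is the problem's mandated namespace (D-0017).
set_option linter.dupNamespace false

noncomputable section

open scoped Classical AddSubgroup

open WeierstrassCurve NumberField IsDedekindDomain Field ValuativeRel
  Literature.NumberTheory.EllipticCurves Literature.NumberTheory.EllipticCurves.GreenbergSelmer
  Literature.NumberTheory.GaloisRepresentations Literature.NumberTheory.EllipticCurves.KellerYin2024
  Literature.NumberTheory.GaloisRepresentations.IsNonarchimedeanLocalField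
  Literature.NumberTheory.EllipticCurves.Rank1Residual
  IsDedekindDomain.HeightOneSpectrum Rat.HeightOneSpectrum
  Summit.BirchSwinnertonDyer.Rank1Residual Summit.BirchSwinnertonDyer.Rank1Residual.X2
  Summit.BirchSwinnertonDyer.BirchSwinnertonDyer.Theorems
  Summit.BirchSwinnertonDyer.BirchSwinnertonDyer.Theorems.SelmerAcQuotientCorankLeCurveLocalLambda

namespace Summit.BirchSwinnertonDyer.BirchSwinnertonDyer.Theorems.EisensteinCharacterInvariantsAtThreeCurveLocalCorank

/-! ## §1 One place: the lower bound at a place of `K` over `N`, off `3` -/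

/-- **GV Prop. (2.4), lower half, at one place `w ∋ N_E`, `3 ∉ w` of the Leopoldt cell**:
`rootMultiplicity((Nw)⁻¹, P̃_w(E_K)) ≤ corank_{ℤ_3} H¹(ker κ ⊓ D_w, E[3^∞])` (`K` imaginary quadratic, (Heeg) for `N_E`,
`κ` anticyclotomic). Additive: `0`; multiplicative with `3 ∤ Nw − a_w`: `0`; multiplicative with `3 ∣ Nw − a_w`: the Tate datum and
`CurveLocalTameCorank.one_le_zpCorank_subgroupH1_inf_decomp`. [cite: GreenbergVatsal2000, §2 Prop. (2.4) pp. 22–23]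
[cite: SilvermanATAEC1994, Ch. V Thm. 3.1, Lemma 5.2 (c), Thm. 5.3 (a),(b), Cor. 5.4] -/
theorem rootMultiplicity_le_zpCorank_of_heegner (W : WeierstrassCurve ℚ) [W.IsElliptic] [W.IsGloballyMinimal]
    {K : Type} [Field K] [NumberField K] (hK : IsImaginaryQuadratic K)
    (hH : SatisfiesHeegnerHypothesis (W.conductorNorm ℤ) K) (κ : ZpExtension K 3) (hκ : κ.IsAnticyclotomic)
    {w : HeightOneSpectrum (𝓞 K)} (hwN : ((W.conductorNorm ℤ : ℤ) : 𝓞 K) ∈ w.asIdeal)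
    (hpw : ((3 : ℕ) : 𝓞 K) ∉ w.asIdeal) :
    (GreenbergVatsal2000.eulerFactorModP (W.baseChange K) 3 w).rootMultiplicity ((w.asIdeal.absNorm : ZMod 3)⁻¹) ≤
      zpCorank (subgroupH1 (κ.kerSubgroup ⊓ decomp w) ((W.baseChange K).geomPrimaryTorsion 3)) 3 := by
  haveI hEKi : (W.baseChange K).IsElliptic := inferInstanceAs (W.map (algebraMap ℚ K)).IsElliptic
  have h32 : (3 : ℕ) ≠ 2 := by decide
  have h23 : 2 < 3 := by decide
  -- the prime `ℓ` below `w` divides `N_E`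
  set u := w.under (𝓞 ℚ) with hu
  have hℓN : natGenerator u ∣ W.conductorNorm ℤ := natGenerator_under_dvd_of_mem w hwN
  have hbad : ¬ W.HasGoodReductionAt u := (W.dvd_conductorNorm_iff u).mp hℓN
  -- `w` is finitely decomposed in `K_∞` (Brink, under (Heeg))
  have hD : ¬ (decomp w ≤ κ.kerSubgroup) :=
    ZpExtension.not_decomp_le_kerSubgroup_of_natCast_mem κ hK hκ hH (by exact_mod_cast hwN) hpw
  have hpos : 0 < numPlacesAbove κ w := NumPlacesAboveRepresentatives.numPlacesAbove_pos κ w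
    (UnrSelmerQuotientTorsionFiniteChar.exists_mem_decomp_apply_ne_one_of_heegner hK h23 hH κ hκ w hwN hpw)
  -- the residue cardinality `q_w = Nw`
  have hq : (residueFieldCard (w.adicCompletion K) : ℤ) = (w.asIdeal.absNorm : ℤ) := by
    rw [Literature.NumberTheory.Automorphic.residueFieldCard_adicCompletion_eq,
      w.residueCard_eq_card_quotient, Ideal.absNorm_apply, Submodule.cardQuot_apply]
  by_cases hadd : W.HasAdditiveReductionAt u
  · -- additive: `P_w = 1`, no root
    have haddK : (W.baseChange K).HasAdditiveReductionAt w := hasAdditiveReductionAt_baseChange_of_heegner W hK hH w hwN hadd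
    have hP : GreenbergVatsal2000.eulerFactorModP (W.baseChange K) 3 w = 1 := by
      unfold GreenbergVatsal2000.eulerFactorModP
      rw [WeierstrassCurve.localPolynomialAt_of_hasAdditiveReductionAt haddK, Polynomial.map_one]
    rw [hP, Polynomial.rootMultiplicity_eq_zero fun h ↦ by simp [Polynomial.IsRoot] at h]
    exact Nat.zero_le _
  · have hmultK : (W.baseChange K).HasMultiplicativeReductionAt w :=
      hasMultiplicativeReductionAt_baseChange_of_heegner W hK hH w hwN hbad hadd
    obtain ⟨φ, hφ⟩ := exists_isFrobPow_holds (F := w.adicCompletion K) 1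
    by_cases hsplitK : (W.baseChange K).HasSplitMultiplicativeReductionAt w
    · -- split multiplicative: multiplicity `𝟙[Nw ≡ 1]`; untwisted Tate datum (`t = 0`)
      have hR := SelmerAcSplitMultiplicativePlace.curveLocalLambda_of_hasSplitMultiplicativeReductionAt (p := 3) κ
        (W.baseChange K) hsplitK
      rw [KellerYin2024.curveLocalLambda_eq] at hR
      rw [Nat.eq_of_mul_eq_mul_left hpos hR]
      split_ifs with h1
      · obtain ⟨q, Φ, hq0, hq1, hsurj, hker, hΦσ, -⟩ :=
          TateCurve.Silverman1994_thmV53_tateUniformisation_holds (W.baseChange K) w hsplitK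
        have hker' : ∀ uu : (AlgebraicClosure (w.adicCompletion K))ˣ, Φ (Additive.ofMul uu) = 0 →
            ∃ a : ℤ, (uu : AlgebraicClosure (w.adicCompletion K)) =
              algebraMap (w.adicCompletion K) (AlgebraicClosure (w.adicCompletion K)) q ^ a :=
          fun uu h ↦ (hker uu).1 h
        have hΨσ := GreenbergVatsalTateDatumSign.sign_of_equivariant (W.baseChange K) Φ hΦσ
        have ht : ∀ σ ∈ absInertia (w.adicCompletion K),
            Field.absoluteGaloisGroup.toAlgEquiv (w.adicCompletion K) σ
              (0 : AlgebraicClosure (w.adicCompletion K)) = 0 := fun σ _ ↦ map_zero _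
        have hcong : ((3 : ℕ) : ℤ) ∣ (residueFieldCard (w.adicCompletion K) : ℤ) -
            (if Field.absoluteGaloisGroup.toAlgEquiv (w.adicCompletion K) φ
              (0 : AlgebraicClosure (w.adicCompletion K)) = 0 then (1 : ℤ) else -1) := by
          rw [if_pos (map_zero _), hq]
          have h := (ZMod.intCast_eq_intCast_iff_dvd_sub (1 : ℤ) (w.asIdeal.absNorm : ℤ) 3).mp
            (by push_cast; exact h1.symm)
          exact_mod_cast h
        exact CurveLocalTameCorank.one_le_zpCorank_subgroupH1_inf_decomp (W.baseChange K) 3 Φ 0 hΨσ hsurj hq0 hq1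
          hker' ht hpw h32 κ hD hφ hcong
      · exact Nat.zero_le _
    · -- non-split multiplicative: multiplicity `𝟙[Nw ≡ −1]`; twisted Tate datum (`t = √γ`, Frobenius flips `t`)
      have hR := SelmerAcMultiplicativePlaceSign.curveLocalLambda_of_not_hasSplitMultiplicativeReductionAt (p := 3) κ
        (W.baseChange K) hmultK hsplitK
      rw [KellerYin2024.curveLocalLambda_eq] at hR
      rw [Nat.eq_of_mul_eq_mul_left hpos hR]
      split_ifs with h1
      · obtain ⟨q, t, Ψ, hq0, hq1, -, ht2, hsurj, hker, hΨσ, -⟩ :=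
          TateCurve.Silverman1994_thmV53_corV54_tateUniformisation_holds (W.baseChange K) w hmultK
        have hker' : ∀ uu : (AlgebraicClosure (w.adicCompletion K))ˣ, Ψ (Additive.ofMul uu) = 0 →
            ∃ a : ℤ, (uu : AlgebraicClosure (w.adicCompletion K)) =
              algebraMap (w.adicCompletion K) (AlgebraicClosure (w.adicCompletion K)) q ^ a :=
          fun uu h ↦ (hker uu).1 h
        have ht := SqrtGammaNonsplitFrobenius.inertia_fix_sqrt_gamma (W.baseChange K) hmultK t ht2
        have hφt := SqrtGammaNonsplitFrobenius.toAlgEquiv_sqrt_gamma_ne_of_not_split (W.baseChange K) hmultK hsplitK hφ ht2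
        have hcong : ((3 : ℕ) : ℤ) ∣ (residueFieldCard (w.adicCompletion K) : ℤ) -
            (if Field.absoluteGaloisGroup.toAlgEquiv (w.adicCompletion K) φ t = t then (1 : ℤ) else -1) := by
          rw [if_neg hφt, hq]
          have h := (ZMod.intCast_eq_intCast_iff_dvd_sub (-1 : ℤ) (w.asIdeal.absNorm : ℤ) 3).mp
            (by push_cast; exact h1.symm)
          exact_mod_cast h
        exact CurveLocalTameCorank.one_le_zpCorank_subgroupH1_inf_decomp (W.baseChange K) 3 Ψ t hΨσ hsurj hq0 hq1
          hker' ht hpw h32 κ hD hφ hcong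
      · exact Nat.zero_le _

/-! ## §2 The registered stub, verbatim -/

/-- **STUB ALG-≥(ii) of line `birth` (registered signature VERBATIM):** on the Leopoldt cell, for every `Sf′` = the places of `K` over
`N` prime to `3` and every `w ∈ Sf′`, `rootMultiplicity((Nw)⁻¹, P̃_w(E_K)) ≤ corank_{ℤ_3} H¹(ker κ ⊓ D_w, E[3^∞])` — §1 at each place
(the cell's residual / Leopoldt data `ClassO6`, `Red`, the line `Φ`, `𝔭`, `𝔭′`, `γ` are carried but not used). Unconditional.
[cite: GreenbergVatsal2000, §2 Prop. (2.4) pp. 22–23] [cite: CastellaGrossiLeeSkinner2022, §1.4 (eq:1) (arXiv:2008.02571v2 TeX L882–901)] -/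
theorem stub_curveLocalCorankGe :
    ∀ (W : WeierstrassCurve ℚ) [W.IsElliptic] [W.IsGloballyMinimal] (N : ℕ) [NeZero N] (K : Type) [Field K] [NumberField K], Summit.BirchSwinnertonDyer.Rank1Residual.Additive.ClassO6 W 3 → Literature.NumberTheory.EllipticCurves.Rank1Residual.Red W 3 → (∃ Φ : AddSubgroup (WeierstrassCurve.geomTorsion W ((3 : ℕ) : ℤ)), Literature.NumberTheory.EllipticCurves.Rank1Residual.IsRationalLine W 3 Φ ∧ ∀ (v : IsDedekindDomain.HeightOneSpectrum (NumberField.RingOfIntegers ℚ)), ((3 : ℕ) : NumberField.RingOfIntegers ℚ) ∈ v.asIdeal → ∀ 𝔓 ∈ v.primesAbove, ¬ (∀ g ∈ 𝔓.decompositionSubgroup (Field.absoluteGaloisGroup ℚ), ∀ P ∈ Φ, g • P = P) ∧ ¬ (∀ g ∈ 𝔓.decompositionSubgroup (Field.absoluteGaloisGroup ℚ), ∀ P : WeierstrassCurve.geomTorsion W ((3 : ℕ) : ℤ), g • P - P ∈ Φ)) → W.conductorNorm ℤ = N → Literature.NumberTheory.EllipticCurves.IsImaginaryQuadratic K → Literature.NumberTheory.EllipticCurves.SatisfiesHeegnerHypothesis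 N K → Odd (NumberField.discr K) → (∀ Q : (W.baseChange K).toAffine.Point, (3 : ℕ) • Q = 0 → Q = 0) → ∀ (κ : Literature.NumberTheory.EllipticCurves.ZpExtension K 3), κ.IsAnticyclotomic → ∀ (γ : Field.absoluteGaloisGroup K) [Fact (κ.IsTopGenerator γ)] (𝔭 : IsDedekindDomain.HeightOneSpectrum (NumberField.RingOfIntegers K)), ((3 : ℕ) : NumberField.RingOfIntegers K) ∈ 𝔭.asIdeal → 𝔭.asIdeal.ramificationIdx (NumberField.RingOfIntegers ℚ) = 1 → 𝔭.asIdeal.inertiaDeg (NumberField.RingOfIntegers ℚ) = 1 → ∀ (𝔭' : IsDedekindDomain.HeightOneSpectrum (NumberField.RingOfIntegers K)), ((3 : ℕ) : NumberField.RingOfIntegers K) ∈ 𝔭'.asIdeal → 𝔭' ≠ 𝔭 → ∀ (Sf' : Finset (IsDedekindDomain.HeightOneSpectrum (NumberField.RingOfIntegers K))), (∀ w : IsDedekindDomain.HeightOneSpectrum (NumberField.RingOfIntegers K), w ∈ Sf' ↔ (((W.conductorNorm ℤ : ℤ) : NumberField.RingOfIntegers K) ∈ w.asIdeal ∧ ((3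 : ℕ) : NumberField.RingOfIntegers K) ∉ w.asIdeal)) → ∀ w ∈ Sf', (Literature.NumberTheory.EllipticCurves.GreenbergVatsal2000.eulerFactorModP (W.baseChange K) 3 w).rootMultiplicity ((w.asIdeal.absNorm : ZMod 3)⁻¹) ≤ Literature.NumberTheory.EllipticCurves.zpCorank (Literature.NumberTheory.EllipticCurves.subgroupH1 (κ.kerSubgroup ⊓ Literature.NumberTheory.EllipticCurves.GreenbergSelmer.decomp w) ((W.baseChange K).geomPrimaryTorsion 3)) 3 := by
  intro W _ _ N _ K _ _ hO6 hRed hcell hN hK hHN hodd hEK κ hκ γ hγI 𝔭 h𝔭 he hf 𝔭' h𝔭' hne Sf' hSf' w hw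
  subst hN
  exact rootMultiplicity_le_zpCorank_of_heegner W hK hHN κ hκ ((hSf' w).mp hw).1 ((hSf' w).mp hw).2

end Summit.BirchSwinnertonDyer.BirchSwinnertonDyer.Theorems.EisensteinCharacterInvariantsAtThreeCurveLocalCorank

end
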